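import Summits.AtomisticToContinuum.FouriersLaw.Theses.PhononMeanFreePath
import Summits.AtomisticToContinuum.FouriersLaw.Theorems.BoundaryKubo.Negative.LoadBearing
import Summits.AtomisticToContinuum.FouriersLaw.Theorems.PhononMeanFreePathBoundaryKuboSumRuleAux2
import Summits.AtomisticToContinuum.FouriersLaw.Theorems.PhononMeanFreePathIncoherentBoundedFixedN
import Summits.AtomisticToContinuum.FouriersLaw.Theorems.PhononMeanFreePathIncoherentBoundedEnergyStatics
import Mathlib.MeasureTheory.Integral.IntegralEqImproper

/-!
# The equilibrium sum rule `∫₀^∞ X + ∫₀^∞ Y = T²/γ`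
(stub `stub_sumRule` of line `gibbs-ttcf`, crux stmt-AtomisticToContinuum-11812 `PhononMeanFreePath.BoundaryKubo`)

For the pinned anharmonic chain `P = pinnedChain ω₂ lam β γ` (all four `> 0`) with `N + 1` sites `0..N`, `T > 0`, Gibbs
measure `μ₀ = gibbsMeasure (N+1) T`, CONSTRUCTED kernels `K_t = transitionKernel (N+1) T T t`, `A = p_N²`, `B = p_0²`, the
equilibrium correlations `X(t) = μ₀(A · K_t A) - μ₀(A) μ₀(K_t A)` (auto-correlation of the right kinetic temperature) and
`Y(t) = kuboIntegrand = μ₀(B · K_t A) - μ₀(B) μ₀(K_t A)` are integrable on `(0, ∞)` and `∫₀^∞ X + ∫₀^∞ Y = T²/γ`.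

Proof. `μ₀(K_t A) = μ₀(A) = μ₀(B) = T` (Gibbs invariance of the kernels, Gaussian momenta), so
`X + Y = μ₀((A + B) · K_t A) - 2T² = -γ⁻¹ μ₀((LH) · K_t A)` with `LH = γ(2T - A - B)` the generator of the energy. The
energy-tested Dynkin identity `μ₀(H · K_S A) - μ₀(H A) = ∫₀^S μ₀((LH) · K_s A) ds` (helper 2, `pinnedChain_sumRule_gibbs`:
Lebesgue duality of the Langevin kernels + Doob–Dynkin for `H` along the reversed equation — no detailed balance) gives
`∫₀^S (X + Y) = -γ⁻¹ (μ₀(H · K_S A) - μ₀(H A))`; as `S → ∞`, `μ₀(H · K_S A) → μ₀(H) μ₀(A)` (exponential decay of centred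
equilibrium correlations, `IncoherentBounded.corr_sub_exp_decay`, i.e. CEHR (2.5) at the Gibbs state), and the static
value is `Cov_{μ₀}(H, p_N²) = T²` (`IncoherentBounded.integral_kinObs_mul_hamiltonian`). Integrability of `X`, `Y`:
the same exponential decay (`pinnedChain_corr_integrableOn`).
-/

noncomputable section

open scoped NNReal ENNReal Topology
open MeasureTheory Filter Set

namespace Summit.AtomisticToContinuum.FouriersLaw.Theorems.BoundaryKubo.GibbsTtcf

open Literature.MathematicalPhysics.KineticTheory.HeatConduction
open Literature.MathematicalPhysics.KineticTheory Literature.Probability.Process OscillatorChain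
open ProbabilityTheory
open Summit.AtomisticToContinuum.FouriersLaw.Theorems.SubdiffusiveBondHeat
open Summit.AtomisticToContinuum.FouriersLaw.Theorems.IncoherentBounded
open Summit.AtomisticToContinuum.FouriersLaw.Theorems.BoundaryKubo.Negative.LoadBearing
  (kuboIntegrand kuboValue LimitClause UniqueSteady SteadyFamily boundaryKubo_iff)

/-! ### Centred equilibrium correlations: integrability on `(0, ∞)` and the limit `t → ∞` -/

section Corr

variable {ω₂ lam β γ : ℝ} (hω : 0 < ω₂) (hl : 0 ≤ lam) (hβ : 0 < β) (hγ : 0 < γ) {N : ℕ} (hN : 0 < N)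
  {T : ℝ} (hT : 0 < T)
include hω hl hβ hγ hN hT

/-- For continuous `|f| ≤ C_f e^{H/(4T)}`, `|g| ≤ C_g e^{H/(4T)}` (`N ≥ 1` sites, both baths at `T > 0`), the centred
equilibrium correlation `u ↦ μ_T(f · K_{u⁺} g) - μ_T(f) μ_T(g)` is integrable on `(0, ∞)` (exponential decay
`IncoherentBounded.corr_sub_exp_decay` and measurability in time `IncoherentBounded.measurable_corr`).
[cite: CuneoEckmannHairerReyBellet2018, Thm 2.13 (3)] -/
theorem pinnedChain_corr_integrableOn {f g : PhaseSpace N → ℝ} (hf : Continuous f) (hg : Continuous g) {Cf Cg : ℝ}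
    (hfb : ∀ y, |f y| ≤ Cf * Real.exp (1 / (4 * T) * (pinnedChain ω₂ lam β γ).hamiltonian N y))
    (hgb : ∀ y, |g y| ≤ Cg * Real.exp (1 / (4 * T) * (pinnedChain ω₂ lam β γ).hamiltonian N y)) :
    IntegrableOn (fun u : ℝ => (∫ z, f z * (∫ y, g y ∂((pinnedChain ω₂ lam β γ).transitionKernel N T T u.toNNReal z))
          ∂((pinnedChain ω₂ lam β γ).gibbsMeasure N T)) -
        (∫ z, f z ∂((pinnedChain ω₂ lam β γ).gibbsMeasure N T)) *
          (∫ z, g z ∂((pinnedChain ω₂ lam β γ).gibbsMeasure N T))) (Ioi 0) := by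
  obtain ⟨C, c, hc, hb⟩ := corr_sub_exp_decay hω hl hβ hγ hN hT hf hg hfb hgb
  refine Integrable.mono' ((exp_neg_integrableOn_Ioi 0 hc).const_mul C)
    ((measurable_corr hω hl hβ hγ hT hf hg).aestronglyMeasurable.sub aestronglyMeasurable_const) ?_
  refine (ae_restrict_iff' measurableSet_Ioi).2 (Eventually.of_forall fun u hu => ?_)
  rw [Real.norm_eq_abs]
  have := hb u.toNNReal
  rwa [Real.coe_toNNReal _ (le_of_lt hu)] at this

/-- … and `μ_T(f · K_{u⁺} g) → μ_T(f) μ_T(g)` as `u → ∞`. [cite: CuneoEckmannHairerReyBellet2018, Thm 2.13 (3)] -/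
theorem pinnedChain_corr_tendsto {f g : PhaseSpace N → ℝ} (hf : Continuous f) (hg : Continuous g) {Cf Cg : ℝ}
    (hfb : ∀ y, |f y| ≤ Cf * Real.exp (1 / (4 * T) * (pinnedChain ω₂ lam β γ).hamiltonian N y))
    (hgb : ∀ y, |g y| ≤ Cg * Real.exp (1 / (4 * T) * (pinnedChain ω₂ lam β γ).hamiltonian N y)) :
    Tendsto (fun u : ℝ => ∫ z, f z * (∫ y, g y ∂((pinnedChain ω₂ lam β γ).transitionKernel N T T u.toNNReal z))
        ∂((pinnedChain ω₂ lam β γ).gibbsMeasure N T)) atTop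
      (𝓝 ((∫ z, f z ∂((pinnedChain ω₂ lam β γ).gibbsMeasure N T)) *
        (∫ z, g z ∂((pinnedChain ω₂ lam β γ).gibbsMeasure N T)))) := by
  obtain ⟨C, c, hc, hb⟩ := corr_sub_exp_decay hω hl hβ hγ hN hT hf hg hfb hgb
  have hlim : Tendsto (fun u : ℝ => C * Real.exp (-c * u)) atTop (𝓝 0) := by
    have : Tendsto (fun u : ℝ => Real.exp (-c * u)) atTop (𝓝 0) := by
      have h := Real.tendsto_exp_neg_atTop_nhds_zero.comp (tendsto_id.const_mul_atTop hc)
      refine h.congr fun u => ?_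
      simp [Function.comp, neg_mul]
    simpa using this.const_mul C
  refine tendsto_sub_nhds_zero_iff.1 (squeeze_zero_norm' ?_ hlim)
  filter_upwards [eventually_ge_atTop 0] with u hu
  rw [Real.norm_eq_abs]
  have := hb u.toNNReal
  rwa [Real.coe_toNNReal _ hu] at this

end Corr

/-! ### The sum rule -/

/-- **STUB `stub_sumRule` of line `gibbs-ttcf` (crux `PhononMeanFreePath.BoundaryKubo`): the equilibrium sum rule.**
For the pinned anharmonic chain with `N + 1` sites (all parameters `> 0`), `T > 0`, `μ₀ = gibbsMeasure (N+1) T`,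
`K_t = transitionKernel (N+1) T T t`, `A = p_N²`, `B = p_0²`: the equilibrium correlations
`X(t) = μ₀(A · K_t A) - μ₀(A) μ₀(K_t A)` and `Y(t) = kuboIntegrand = μ₀(B · K_t A) - μ₀(B) μ₀(K_t A)` are integrable on
`(0, ∞)` and `∫₀^∞ X + ∫₀^∞ Y = T²/γ`. Proof: `μ₀(K_t A) = μ₀(A) = μ₀(B) = T` (Gibbs invariance, Gaussian momenta), so
`X + Y = μ₀((A + B - 2T) K_t A) = -γ⁻¹ μ₀((LH) · K_t A)` with `LH = γ(2T - A - B)`; the energy-tested Dynkin identity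
`μ₀(H · K_S A) - μ₀(H A) = ∫₀^S μ₀((LH) · K_s A) ds` (`pinnedChain_sumRule_gibbs`: Lebesgue duality + Doob–Dynkin for
`H` along the reversed equation — no detailed balance needed) gives `∫₀^S (X + Y) = -γ⁻¹ (μ₀(H · K_S A) - μ₀(H A))`;
as `S → ∞`, `μ₀(H · K_S A) → μ₀(H) μ₀(A)` (Harris decay at the Gibbs state), and `Cov_{μ₀}(H, p_N²) = T²` (one Gaussian
integration by parts). Integrability: exponential decay of centred equilibrium correlations. [folklore] -/
theorem stub_sumRule :
    ∀ ω₂ lam β γ : ℝ, 0 < ω₂ → 0 < lam → 0 < β → 0 < γ → ∀ (N : ℕ) (T : ℝ), 0 < T →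
      IntegrableOn (kuboIntegrand ω₂ lam β γ T N) (Ioi 0) ∧
      IntegrableOn (fun t : ℝ => ((∫ z, (z.2 (Fin.last N)) ^ 2 * (∫ y, (y.2 (Fin.last N)) ^ 2
              ∂((pinnedChain ω₂ lam β γ).transitionKernel (N + 1) T T t.toNNReal z))
              ∂((pinnedChain ω₂ lam β γ).gibbsMeasure (N + 1) T)) -
            (∫ z, (z.2 (Fin.last N)) ^ 2 ∂((pinnedChain ω₂ lam β γ).gibbsMeasure (N + 1) T)) *
              (∫ z, (∫ y, (y.2 (Fin.last N)) ^ 2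
                ∂((pinnedChain ω₂ lam β γ).transitionKernel (N + 1) T T t.toNNReal z))
                ∂((pinnedChain ω₂ lam β γ).gibbsMeasure (N + 1) T)))) (Ioi 0) ∧
      (∫ t in Ioi (0 : ℝ), ((∫ z, (z.2 (Fin.last N)) ^ 2 * (∫ y, (y.2 (Fin.last N)) ^ 2
              ∂((pinnedChain ω₂ lam β γ).transitionKernel (N + 1) T T t.toNNReal z))
              ∂((pinnedChain ω₂ lam β γ).gibbsMeasure (N + 1) T)) -
            (∫ z, (z.2 (Fin.last N)) ^ 2 ∂((pinnedChain ω₂ lam β γ).gibbsMeasure (N + 1) T)) *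
              (∫ z, (∫ y, (y.2 (Fin.last N)) ^ 2
                ∂((pinnedChain ω₂ lam β γ).transitionKernel (N + 1) T T t.toNNReal z))
                ∂((pinnedChain ω₂ lam β γ).gibbsMeasure (N + 1) T)))) +
          (∫ t in Ioi (0 : ℝ), kuboIntegrand ω₂ lam β γ T N t) = T ^ 2 / γ := by
  intro ω₂ lam β γ hω hl hβ hγ N T hT
  -- notation
  set P := pinnedChain ω₂ lam β γ with hPdef
  have hP : P.IsConfining := pinnedChain_isConfining hω hl.le hβ.le hγ.le
  have hM : 0 < N + 1 := Nat.succ_pos N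
  set μ := P.gibbsMeasure (N + 1) T with hμ
  haveI : IsProbabilityMeasure μ := pinnedChain_isProbabilityMeasure_gibbsMeasure hω hl.le hβ.le γ (N + 1) hT
  set K : ℝ≥0 → Kernel (PhaseSpace (N + 1)) (PhaseSpace (N + 1)) := P.transitionKernel (N + 1) T T with hK
  set Hm := P.hamiltonian (N + 1) with hHm
  set A : PhaseSpace (N + 1) → ℝ := fun y => (y.2 (Fin.last N)) ^ 2 with hA
  set B : PhaseSpace (N + 1) → ℝ := fun y => (y.2 0) ^ 2 with hB
  set KA : ℝ → PhaseSpace (N + 1) → ℝ := fun t z => ∫ y, A y ∂(K t.toNNReal z) with hKA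
  set X : ℝ → ℝ := fun t => (∫ z, A z * KA t z ∂μ) - (∫ z, A z ∂μ) * (∫ z, KA t z ∂μ) with hX
  set Y : ℝ → ℝ := fun t => (∫ z, B z * KA t z ∂μ) - (∫ z, B z ∂μ) * (∫ z, KA t z ∂μ) with hY
  show IntegrableOn Y (Ioi 0) ∧ IntegrableOn X (Ioi 0) ∧ (∫ t in Ioi (0:ℝ), X t) + (∫ t in Ioi (0:ℝ), Y t) = T ^ 2 / γ
  -- exponential bounds of `A`, `B`, `H`, `1` with the exponent `ϑ = 1/(4T)`
  have hϑ0 : (0:ℝ) < 1 / (4 * T) := by positivity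
  have h2ϑ : 2 * (1 / (4 * T)) < 1 / T := by
    rw [show 2 * (1 / (4 * T)) = 1 / (2 * T) by field_simp; ring]
    exact one_div_lt_one_div_of_lt hT (by linarith)
  have hϑ1 : 1 / (4 * T) < 1 / T := by linarith
  have hAc : Continuous A := by rw [hA]; fun_prop
  have hBc : Continuous B := by rw [hB]; fun_prop
  have hHc : Continuous Hm := pinnedChain_continuous_hamiltonian ω₂ lam β γ (N + 1)
  have hH0 : ∀ x, 0 ≤ Hm x := fun x => hP.hamiltonian_nonneg (N + 1) x
  have hAb : ∀ y, |A y| ≤ 2 / (1 / (4 * T)) * Real.exp (1 / (4 * T) * Hm y) := fun y =>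
    abs_sq_momentum_le_exp hP hϑ0 (N + 1) y _
  have hBb : ∀ y, |B y| ≤ 2 / (1 / (4 * T)) * Real.exp (1 / (4 * T) * Hm y) := fun y =>
    abs_sq_momentum_le_exp hP hϑ0 (N + 1) y _
  have hHb : ∀ x, |Hm x| ≤ 1 / (1 / (4 * T)) * Real.exp (1 / (4 * T) * Hm x) := fun x => by
    rw [abs_of_nonneg (hH0 x), one_div_mul_eq_div]; exact hamiltonian_le_exp (γ := γ) hϑ0 x
  have h1b : ∀ x : PhaseSpace (N + 1), |(1:ℝ)| ≤ 1 * Real.exp (1 / (4 * T) * Hm x) := fun x => by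
    rw [abs_one, one_mul]; exact Real.one_le_exp (mul_nonneg hϑ0.le (hH0 x))
  -- statics: `μ₀(A) = μ₀(B) = T`, `μ₀(H A) - μ₀(H) T = T²`
  have hμA : ∫ z, A z ∂μ = T := integral_momentum_sq_gibbsMeasure hω hl.le hβ hT (N + 1) (Fin.last N)
  have hμB : ∫ z, B z ∂μ = T := integral_momentum_sq_gibbsMeasure hω hl.le hβ hT (N + 1) 0
  have hwt1 := pinnedChain_integrable_exp_mul_hamiltonian_gibbsMeasure hω hl.le hβ.le γ (N + 1) hT hϑ1
  have hwt2 := pinnedChain_integrable_exp_mul_hamiltonian_gibbsMeasure hω hl.le hβ.le γ (N + 1) hT h2ϑ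
  have hHint : Integrable Hm μ := integrable_of_abs_le_exp hwt1 hHc hHb
  have hHAint : Integrable (fun z => Hm z * A z) μ :=
    integrable_of_abs_le_exp hwt2 (hHc.mul hAc) (C := 1 / (1 / (4 * T)) * (2 / (1 / (4 * T)))) fun z => by
      rw [abs_mul]
      calc |Hm z| * |A z| ≤ (1 / (1 / (4 * T)) * Real.exp (1 / (4 * T) * Hm z)) *
          (2 / (1 / (4 * T)) * Real.exp (1 / (4 * T) * Hm z)) := mul_le_mul (hHb z) (hAb z) (abs_nonneg _) (by positivity)
        _ = 1 / (1 / (4 * T)) * (2 / (1 / (4 * T))) * Real.exp (2 * (1 / (4 * T)) * Hm z) := by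
          rw [show 2 * (1 / (4 * T)) * Hm z = 1 / (4 * T) * Hm z + 1 / (4 * T) * Hm z by ring, Real.exp_add]; ring
  have hcov : (∫ z, Hm z * A z ∂μ) - (∫ z, Hm z ∂μ) * T = T ^ 2 := by
    have h := integral_kinObs_mul_hamiltonian (γ := γ) hω hl.le hβ.le hT (n := N + 1) (Fin.last N)
    have e : ∀ z : PhaseSpace (N + 1), (z.2 (Fin.last N) ^ 2 - T) * Hm z = Hm z * A z - T * Hm z := fun z => by
      simp only [hA]; ring
    rw [integral_congr_ae (Eventually.of_forall e), integral_sub hHAint (hHint.const_mul T), integral_const_mul] at h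
    linarith
  -- Gibbs invariance: `μ₀(K_t A) = μ₀(A) = T`
  have hinv : ∀ t : ℝ, ∫ z, KA t z ∂μ = T := fun t => by
    simp only [hKA, hA]; rw [mean_act_sq_momentum hω hl.le hβ hγ hT N (Fin.last N) t]; exact hμA
  -- integrability of `A · K_tA`, `B · K_tA`, `K_tA` under `μ₀`
  have hiA : ∀ t : ℝ, Integrable (fun z => A z * KA t z) μ := fun t =>
    integrable_mul_act hω hl.le hβ hγ hT hAc hAc hAb hAb t.toNNReal
  have hiB : ∀ t : ℝ, Integrable (fun z => B z * KA t z) μ := fun t =>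
    integrable_mul_act hω hl.le hβ hγ hT hBc hAc hBb hAb t.toNNReal
  have hi1 : ∀ t : ℝ, Integrable (fun z => KA t z) μ := fun t =>
    (integrable_mul_act hω hl.le hβ hγ hT continuous_const hAc h1b hAb t.toNNReal).congr
      (Eventually.of_forall fun z => one_mul _)
  -- the centred forms of `X`, `Y` and their integrability on `(0, ∞)`
  have hXeq : ∀ t, X t = (∫ z, A z * KA t z ∂μ) - (∫ z, A z ∂μ) * (∫ z, A z ∂μ) := fun t => by
    simp only [hX]; rw [hinv, hμA]
  have hYeq : ∀ t, Y t = (∫ z, B z * KA t z ∂μ) - (∫ z, B z ∂μ) * (∫ z, A z ∂μ) := fun t => by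
    simp only [hY]; rw [hinv, hμA]
  have hXint : IntegrableOn X (Ioi 0) :=
    (pinnedChain_corr_integrableOn hω hl.le hβ hγ hM hT hAc hAc hAb hAb).congr_fun
      (fun t _ => (hXeq t).symm) measurableSet_Ioi
  have hYint : IntegrableOn Y (Ioi 0) :=
    (pinnedChain_corr_integrableOn hω hl.le hβ hγ hM hT hBc hAc hBb hAb).congr_fun
      (fun t _ => (hYeq t).symm) measurableSet_Ioi
  refine ⟨hYint, hXint, ?_⟩
  -- `X + Y = -γ⁻¹ μ₀((LH) · K_t A)` and the energy-tested Dynkin identity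
  have hsum : ∀ t, ∫ z, γ * (2 * T - ((z.2 0) ^ 2 + (z.2 (Fin.last N)) ^ 2)) * KA t z ∂μ = -γ * (X t + Y t) := by
    intro t
    have e : ∀ z : PhaseSpace (N + 1), γ * (2 * T - ((z.2 0) ^ 2 + (z.2 (Fin.last N)) ^ 2)) * KA t z =
        γ * (2 * T * KA t z - (B z * KA t z + A z * KA t z)) := fun z => by simp only [hA, hB]; ring
    have h23 : Integrable (fun z => B z * KA t z + A z * KA t z) μ := (hiB t).add (hiA t)
    rw [integral_congr_ae (Eventually.of_forall e), integral_const_mul, integral_sub ((hi1 t).const_mul _) h23,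
      integral_const_mul, integral_add (hiB t) (hiA t), hinv, hXeq, hYeq, hμA, hμB]
    ring
  have hfin : ∀ S : ℝ, 0 ≤ S → ∫ t in (0:ℝ)..S, (X t + Y t) =
      -(1 / γ) * ((∫ z, Hm z * KA S z ∂μ) - ∫ z, Hm z * A z ∂μ) := by
    intro S hS
    have h := pinnedChain_sumRule_gibbs hω hl.le hβ.le hγ.le N hT hS
    have e : ∫ t in (0:ℝ)..S, (X t + Y t) = -(1 / γ) * ∫ t in (0:ℝ)..S,
        ∫ z, γ * (2 * T - ((z.2 0) ^ 2 + (z.2 (Fin.last N)) ^ 2)) * KA t z ∂μ := by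
      rw [← intervalIntegral.integral_const_mul]
      refine intervalIntegral.integral_congr fun t _ => ?_
      show X t + Y t = -(1 / γ) * ∫ z, γ * (2 * T - ((z.2 0) ^ 2 + (z.2 (Fin.last N)) ^ 2)) * KA t z ∂μ
      rw [hsum t]; field_simp
    rw [e]
    exact congrArg _ h.symm
  -- the limit `S → ∞`
  have hlimL : Tendsto (fun S => ∫ t in (0:ℝ)..S, (X t + Y t)) atTop (𝓝 (∫ t in Ioi (0:ℝ), (X t + Y t))) :=
    intervalIntegral_tendsto_integral_Ioi 0 (hXint.add hYint) tendsto_id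
  have hlimR : Tendsto (fun S : ℝ => -(1 / γ) * ((∫ z, Hm z * KA S z ∂μ) - ∫ z, Hm z * A z ∂μ)) atTop
      (𝓝 (-(1 / γ) * ((∫ z, Hm z ∂μ) * (∫ z, A z ∂μ) - ∫ z, Hm z * A z ∂μ))) :=
    ((pinnedChain_corr_tendsto hω hl.le hβ hγ hM hT hHc hAc hHb hAb).sub_const _).const_mul _
  have hval : ∫ t in Ioi (0:ℝ), (X t + Y t) = -(1 / γ) * ((∫ z, Hm z ∂μ) * (∫ z, A z ∂μ) - ∫ z, Hm z * A z ∂μ) := by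
    refine tendsto_nhds_unique (hlimL.congr' ?_) hlimR
    filter_upwards [eventually_ge_atTop 0] with S hS
    exact hfin S hS
  rw [← integral_add hXint hYint, hval, hμA]
  have hγ0 : γ ≠ 0 := hγ.ne'
  field_simp
  linarith [hcov]

end Summit.AtomisticToContinuum.FouriersLaw.Theorems.BoundaryKubo.GibbsTtcf

end
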